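import Literature.Analysis.SpecialFunctions.RiemannThetaLefschetz
import Literature.Geometry.Kaehler.ComplexTorusCover
import Literature.NumberTheory.Transcendental.ProjectiveSpaceProofs
import HarnessLib

/-!
# Lefschetz's theorem: the theta functions of level three embed a principally polarised complex torus into projective space

Let `Ω` be a point of the Siegel upper half space `𝔥ₙ` (`Ω` symmetric, `Im Ω` positive definite)
and `X = ℂⁿ/(ℤⁿ ⊕ Ωℤⁿ)` the principally polarised complex torus it defines, presented as the
tree's `ComplexTorus Φ` for the period isomorphism `Φ : ℝⁿ ⊕ ℝⁿ ≃ ℂⁿ`, `(x, y) ↦ x + Ωy`.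
**Lefschetz's theorem** (Mumford, *Tata Lectures on Theta I*, Ch. II §1 Thm. 1.3: "for `ℓ ≥ 3`,
`φ_ℓ` is an embedding of the complex torus `ℂ^g/L_Ω` in projective space"; Lange–Birkenhake,
*Complex Abelian Varieties*, Thm. 4.5.1; Griffiths–Harris Ch. 2 §6; Mumford, *Abelian Varieties*
§3): the `3ⁿ` theta functions of level three `f_c(z) = e^{2πi ᵗc z} ϑ(3z + Ωc, 3Ω)` define a map
`F : X → ℙ^{3ⁿ-1}(ℂ)`, `π(z) ↦ [f_c(z)]_c`, which is **holomorphic, injective, and an immersion**.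

* `siegelTorus_thetaEmbedding` — **the theorem**, in the exact typing of the registered stub
  `stub_thetaEmbedding` of crux `RiemannWeightOne` (stmt-HodgeConjecture-16406, route
  `SecondaryPeriods`): `∃ N F, ContMDiff 𝓘(ℂ, ℂⁿ) 𝓘(ℂ, ℂ^N) ω F ∧ Injective F ∧ ∀ x, Injective (mfderiv F x)`.

The analysis is `Literature.Analysis.SpecialFunctions.exists_lefschetz_levelThree_family_of_posDef`
(the `f_c` are entire, `ℤⁿ`-periodic, have the common automorphy factor of `L³` along `Ωℤⁿ`, no
common zero, separate points modulo the lattice and separate tangent vectors). This file is the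
manifold packaging:

* `contMDiffAt_projectivizationMk`, `exists_eq_mul_of_mfderiv_projectivizationMk_eq_zero` — a map
  `y ↦ [g(y)]` into `ℙᴺ(ℂ)` given by holomorphic homogeneous coordinates without common zero is
  holomorphic, and a tangent vector killed by its differential satisfies `dg(u) = μ g` (computed in
  the standard chart `(g_j/g_{i₀})_j` of `Literature.NumberTheory.Transcendental.ProjectiveSpace`);
* descent to the torus through the covering map `ComplexTorus.cover` (`extChartAt_symm_eq_cover`,
  `mfderiv_cover = id`): the lattice `Φ(ℤ²ⁿ) = ℤⁿ ⊕ Ωℤⁿ` acts on the homogeneous coordinates by the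
  common automorphy factor, so `[f_c]` is lattice invariant.

Everything is proved; no definitions, no named facts.

## References

* [MumfordTata1] D. Mumford, Tata Lectures on Theta I (1983), Ch. II §1, Thm. 1.3.
* [LangeBirkenhake1992] H. Lange, Ch. Birkenhake, Complex Abelian Varieties (1992), Thm. 4.5.1,
  Lemma 1.1.3.
* [GriffithsHarris1978] P. Griffiths, J. Harris, Principles of Algebraic Geometry (1978), Ch. 2 §6.
* [MumfordAV1970] D. Mumford, Abelian Varieties (1970), §3.
-/

noncomputable section

open scoped Manifold ContDiff Topology LinearAlgebra.Projectivization Real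
open Set Filter Complex
open Literature.Analysis.SpecialFunctions Literature.Analysis.Complex

namespace Literature.Geometry.Kaehler

/-! ### Maps into projective space from holomorphic homogeneous coordinates -/

section ProjectiveMaps

variable {E : Type*} [NormedAddCommGroup E] [NormedSpace ℂ E] {N : ℕ}

omit [NormedAddCommGroup E] [NormedSpace ℂ E] in
/-- The chosen standard chart at `[g(z)]` has a non-vanishing coordinate `g_{i₀}(z) ≠ 0`. [folklore] -/
theorem apply_chartIndex_ne_zero {g : E → Fin (N + 1) → ℂ} (hz : ∀ y, g y ≠ 0) {z : E}
    {i₀ : Fin (N + 1)}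
    (hi₀ : Classical.choose (Projectivization.exists_rep_apply_ne_zero
      (Projectivization.mk ℂ (g z) (hz z))) = i₀) :
    g z i₀ ≠ 0 := by
  have hrep := Classical.choose_spec (Projectivization.exists_rep_apply_ne_zero
    (Projectivization.mk ℂ (g z) (hz z)))
  rw [hi₀] at hrep
  exact (Projectivization.mk_mem_stdChartSource_iff i₀ (g z) (hz z)).mp hrep

/-- **`y ↦ [g(y)]` is holomorphic** when the homogeneous coordinates `g_k` are holomorphic without
common zero: in the standard chart at `[g(z)]` it reads `y ↦ (g_{i₀.succAbove j}(y)/g_{i₀}(y))_j`.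
[cite: GriffithsHarris1978, Ch. 0 §2 and Ch. 1 §3 (holomorphic maps to ℙⁿ)] -/
theorem contMDiffAt_projectivizationMk {g : E → Fin (N + 1) → ℂ} (hz : ∀ y, g y ≠ 0)
    (hgc : Continuous g) {z : E} (hg : ∀ k, ContDiffAt ℂ ω (fun y => g y k) z) :
    ContMDiffAt 𝓘(ℂ, E) 𝓘(ℂ, Fin N → ℂ) ω (fun y => Projectivization.mk ℂ (g y) (hz y)) z := by
  obtain ⟨i₀, hi₀⟩ : ∃ i₀ : Fin (N + 1), Classical.choose (Projectivization.exists_rep_apply_ne_zero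
      (Projectivization.mk ℂ (g z) (hz z))) = i₀ := ⟨_, rfl⟩
  have hgi := apply_chartIndex_ne_zero hz hi₀
  rw [contMDiffAt_iff_target]
  refine ⟨(Projectivization.continuous_mk.comp (hgc.subtype_mk hz)).continuousAt, ?_⟩
  have hfun : (extChartAt 𝓘(ℂ, Fin N → ℂ) (Projectivization.mk ℂ (g z) (hz z)) ∘
      fun y => Projectivization.mk ℂ (g y) (hz y)) =
      fun y j => g y (i₀.succAbove j) / g y i₀ := by
    funext y
    simp [Projectivization.chartAt_eq, hi₀]
  rw [hfun, contMDiffAt_iff_contDiffAt]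
  exact contDiffAt_pi.mpr fun j => (hg _).div (hg i₀) hgi

/-- **The differential of `y ↦ [g(y)]`** at `z`, in the standard chart at `[g(z)]`, is the
derivative of `y ↦ (g_{i₀.succAbove j}(y)/g_{i₀}(y))_j`. [cite: GriffithsHarris1978, Ch. 0 §2] -/
theorem hasMFDerivAt_projectivizationMk {g : E → Fin (N + 1) → ℂ} (hz : ∀ y, g y ≠ 0)
    (hgc : Continuous g) {z : E} {i₀ : Fin (N + 1)}
    (hi₀ : Classical.choose (Projectivization.exists_rep_apply_ne_zero
      (Projectivization.mk ℂ (g z) (hz z))) = i₀)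
    (hg : ∀ k, DifferentiableAt ℂ (fun y => g y k) z) :
    HasMFDerivAt 𝓘(ℂ, E) 𝓘(ℂ, Fin N → ℂ) (fun y => Projectivization.mk ℂ (g y) (hz y)) z
      (fderiv ℂ (fun y j => g y (i₀.succAbove j) * (g y i₀)⁻¹) z) := by
  have hgi := apply_chartIndex_ne_zero hz hi₀
  refine ⟨(Projectivization.continuous_mk.comp (hgc.subtype_mk hz)).continuousAt, ?_⟩
  have hfun : writtenInExtChartAt 𝓘(ℂ, E) 𝓘(ℂ, Fin N → ℂ) z
      (fun y => Projectivization.mk ℂ (g y) (hz y)) =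
      fun y j => g y (i₀.succAbove j) * (g y i₀)⁻¹ := by
    funext y
    simp [writtenInExtChartAt, Projectivization.chartAt_eq, hi₀, div_eq_mul_inv]
  rw [hfun, extChartAt_model_space_eq_id, PartialEquiv.refl_coe, id_eq]
  have hφd : DifferentiableAt ℂ (fun y j => g y (i₀.succAbove j) * (g y i₀)⁻¹) z :=
    differentiableAt_pi.mpr fun j => (hg _).mul ((hg i₀).inv hgi)
  exact hφd.hasFDerivAt.hasFDerivWithinAt

/-- **A tangent vector killed by `d[g]` is an infinitesimal rescaling**: if `u` is in the kernel of
the differential of `y ↦ [g(y)]` at `z`, then `dg_k(z)(u) = μ g_k(z)` for one `μ` and all `k`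
(write `g_j = (g_j/g_{i₀}) · g_{i₀}` near `z` and differentiate). [cite: GriffithsHarris1978, Ch. 0 §2] -/
theorem exists_eq_mul_of_mfderiv_projectivizationMk_eq_zero {g : E → Fin (N + 1) → ℂ}
    (hz : ∀ y, g y ≠ 0) (hgc : Continuous g) {z : E} (hg : ∀ k, DifferentiableAt ℂ (fun y => g y k) z)
    {u : E}
    (hu : mfderiv 𝓘(ℂ, E) 𝓘(ℂ, Fin N → ℂ) (fun y => Projectivization.mk ℂ (g y) (hz y)) z u = 0) :
    ∃ μ : ℂ, ∀ k, fderiv ℂ (fun y => g y k) z u = μ * g z k := by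
  obtain ⟨i₀, hi₀⟩ : ∃ i₀ : Fin (N + 1), Classical.choose (Projectivization.exists_rep_apply_ne_zero
      (Projectivization.mk ℂ (g z) (hz z))) = i₀ := ⟨_, rfl⟩
  have hgi := apply_chartIndex_ne_zero hz hi₀
  rw [(hasMFDerivAt_projectivizationMk hz hgc hi₀ hg).mfderiv] at hu
  have hφd : ∀ j, DifferentiableAt ℂ (fun y => g y (i₀.succAbove j) * (g y i₀)⁻¹) z := fun j =>
    (hg _).mul ((hg i₀).inv hgi)
  have hu' : fderiv ℂ (fun y j => g y (i₀.succAbove j) * (g y i₀)⁻¹) z u = 0 := hu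
  have hcomp : ∀ j, fderiv ℂ (fun y => g y (i₀.succAbove j) * (g y i₀)⁻¹) z u = 0 := by
    intro j
    have h1 := congrFun hu' j
    rw [fderiv_pi hφd] at h1
    simpa only [ContinuousLinearMap.pi_apply, Pi.zero_apply] using h1
  have hloc : ∀ j, (fun y => g y (i₀.succAbove j)) =ᶠ[𝓝 z]
      fun y => (g y (i₀.succAbove j) * (g y i₀)⁻¹) * g y i₀ := by
    intro j
    have hci : ContinuousAt (fun y => g y i₀) z := (hg i₀).continuousAt
    filter_upwards [hci.eventually_ne hgi] with y hy
    rw [inv_mul_cancel_right₀ hy]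
  have hderiv : ∀ j, fderiv ℂ (fun y => g y (i₀.succAbove j)) z u =
      (g z (i₀.succAbove j) * (g z i₀)⁻¹) * fderiv ℂ (fun y => g y i₀) z u := by
    intro j
    rw [(hloc j).fderiv_eq (𝕜 := ℂ), fderiv_fun_mul (hφd j) (hg i₀)]
    simp only [_root_.add_apply, FunLike.coe_smul, Pi.smul_apply, smul_eq_mul, hcomp j, mul_zero,
      add_zero]
  refine ⟨fderiv ℂ (fun y => g y i₀) z u * (g z i₀)⁻¹, fun k => ?_⟩
  rcases Fin.eq_self_or_eq_succAbove i₀ k with rfl | ⟨j, rfl⟩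
  · rw [inv_mul_cancel_right₀ hgi]
  · rw [hderiv j]
    ring

end ProjectiveMaps

/-! ### The theta embedding of the Siegel torus -/

section ThetaEmbedding

variable {n : ℕ}

/-- The lattice of `ComplexTorus Φ` for the Siegel period isomorphism `(x, y) ↦ x + Ωy` is
`ℤⁿ ⊕ Ωℤⁿ`: `Φ(v) = (v₁ᵢ + Σⱼ Ωᵢⱼ v₂ⱼ)ᵢ` for `v ∈ ℤ²ⁿ`. [cite: LangeBirkenhake1992, §8.1] -/
theorem latticeVec_siegel (Ω : Matrix (Fin n) (Fin n) ℂ) (Φ : (Fin n ⊕ Fin n → ℝ) ≃L[ℝ] (Fin n → ℂ))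
    (hΦ : ∀ v i, Φ v i = (v (Sum.inl i) : ℂ) + ∑ j, Ω i j * (v (Sum.inr j) : ℂ))
    (v : Fin n ⊕ Fin n → ℤ) (i : Fin n) :
    ComplexTorus.latticeVec Φ v i =
      ((v (Sum.inl i) : ℤ) : ℂ) + ∑ j, Ω i j * ((v (Sum.inr j) : ℤ) : ℂ) := by
  rw [ComplexTorus.latticeVec, hΦ]
  simp only [Complex.ofReal_intCast]

/-- **Lefschetz's theorem for the Siegel torus `ℂⁿ/(ℤⁿ ⊕ Ωℤⁿ)`** (`Ω` symmetric with positive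
definite imaginary part), in the typing of the registered stub `stub_thetaEmbedding` of crux
`RiemannWeightOne`: there are `N` (`= 3ⁿ - 1`) and a map `F : ComplexTorus Φ → ℙᴺ(ℂ)` — the theta
map of level three `π(z) ↦ [e^{2πi ᵗc z} ϑ(3z + Ωc, 3Ω)]_{c ∈ {0,1,2}ⁿ}` — which is holomorphic,
injective, and has injective differential everywhere. [cite: MumfordTata1, Ch. II §1 Thm. 1.3]
[cite: LangeBirkenhake1992, Thm. 4.5.1] [cite: GriffithsHarris1978, Ch. 2 §6 (The Lefschetz theorem)]
[cite: MumfordAV1970, §3 (Theorem of Lefschetz)] -/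
theorem siegelTorus_thetaEmbedding (Ω : Matrix (Fin n) (Fin n) ℂ) (hΩ : ∀ i j, Ω i j = Ω j i)
    (hpos : (Matrix.of fun i j => (Ω i j).im).PosDef)
    (Φ : (Fin n ⊕ Fin n → ℝ) ≃L[ℝ] (Fin n → ℂ))
    (hΦ : ∀ v i, Φ v i = (v (Sum.inl i) : ℂ) + ∑ j, Ω i j * (v (Sum.inr j) : ℂ)) :
    ∃ (N : ℕ) (F : ComplexTorus Φ → ℙ ℂ (Fin (N + 1) → ℂ)),
      ContMDiff 𝓘(ℂ, Fin n → ℂ) 𝓘(ℂ, Fin N → ℂ) ω F ∧ Function.Injective F ∧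
        ∀ x, Function.Injective (mfderiv 𝓘(ℂ, Fin n → ℂ) 𝓘(ℂ, Fin N → ℂ) F x) := by
  obtain ⟨f, hdiff, hper, hqper, hbpf, hinj, himm⟩ :=
    exists_lefschetz_levelThree_family_of_posDef Ω hΩ hpos
  -- enumerate the indices `{0,1,2}ⁿ` by `Fin (N + 1)`, `N + 1 = 3ⁿ`
  have hcard : Fintype.card (Fin n → Fin 3) = (3 ^ n - 1) + 1 := by
    rw [Fintype.card_fun, Fintype.card_fin, Fintype.card_fin]
    have := Nat.one_le_pow n 3 (by norm_num)
    omega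
  set N : ℕ := 3 ^ n - 1 with hN
  set σ : Fin (N + 1) ≃ (Fin n → Fin 3) := (Fintype.equivFinOfCardEq hcard).symm with hσ
  -- homogeneous coordinates
  set gv : (Fin n → ℂ) → Fin (N + 1) → ℂ := fun z k => f (σ k) z with hgv
  have hgv0 : ∀ z, gv z ≠ 0 := by
    intro z h0
    obtain ⟨c₃, hc₃⟩ := hbpf z
    have := congrFun h0 (σ.symm c₃)
    simp only [hgv, Equiv.apply_symm_apply, Pi.zero_apply] at this
    exact hc₃ this
  have hgvc : Continuous gv := continuous_pi fun k => (hdiff (σ k)).continuous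
  have hgvd : ∀ z k, DifferentiableAt ℂ (fun y => gv y k) z := fun z k => hdiff (σ k) z
  have hgva : ∀ z k, ContDiffAt ℂ ω (fun y => gv y k) z := fun z k =>
    (ThetaRigidity.analyticOnNhd_univ (hdiff (σ k)) z (mem_univ z)).contDiffAt
  set G : (Fin n → ℂ) → ℙ ℂ (Fin (N + 1) → ℂ) := fun z => Projectivization.mk ℂ (gv z) (hgv0 z)
    with hG
  -- lattice invariance of `G`
  have hGper : ∀ (z : Fin n → ℂ) (v : Fin n ⊕ Fin n → ℤ),
      G (z + ComplexTorus.latticeVec Φ v) = G z := by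
    intro z v
    set m : Fin n → ℤ := fun i => v (Sum.inl i) with hm
    set n' : Fin n → ℤ := fun j => v (Sum.inr j) with hn'
    have hz : z + ComplexTorus.latticeVec Φ v =
        fun i => (fun i => z i + ∑ j, Ω i j * (n' j : ℂ)) i + (m i : ℂ) := by
      funext i
      rw [Pi.add_apply, latticeVec_siegel Ω Φ hΦ v i]
      simp only [hm, hn']
      ring
    have hcoord : ∀ k, gv (z + ComplexTorus.latticeVec Φ v) k =
        cexp (3 * (-(π * I * ∑ i, ∑ j, (n' i : ℂ) * Ω i j * (n' j : ℂ)) -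
          2 * π * I * ∑ i, (n' i : ℂ) * z i)) * gv z k := by
      intro k
      simp only [hgv]
      rw [hz, hper, hqper]
    simp only [hG]
    rw [Projectivization.mk_eq_mk_iff']
    exact ⟨cexp (3 * (-(π * I * ∑ i, ∑ j, (n' i : ℂ) * Ω i j * (n' j : ℂ)) -
      2 * π * I * ∑ i, (n' i : ℂ) * z i)), funext fun k => by rw [Pi.smul_apply, smul_eq_mul, hcoord k]⟩
  have hGper' : ∀ (z : Fin n → ℂ) (v : Fin n ⊕ Fin n → ℤ),
      G (z - ComplexTorus.latticeVec Φ v) = G z := by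
    intro z v
    have := hGper (z - ComplexTorus.latticeVec Φ v) v
    rw [sub_add_cancel] at this
    exact this.symm
  -- smoothness of `G`
  have hGsmooth : ContMDiff 𝓘(ℂ, Fin n → ℂ) 𝓘(ℂ, Fin N → ℂ) ω G := fun z =>
    contMDiffAt_projectivizationMk hgv0 hgvc (hgva z)
  -- the map on the torus
  set F : ComplexTorus Φ → ℙ ℂ (Fin (N + 1) → ℂ) := fun t =>
    G (extChartAt 𝓘(ℂ, Fin n → ℂ) t t) with hF
  have hFcover : ∀ z, F (ComplexTorus.cover Φ z) = G z := by
    intro z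
    simp only [hF]
    rw [ComplexTorus.extChartAt_cover_self]
    exact hGper' z _
  have hFsmooth : ContMDiff 𝓘(ℂ, Fin n → ℂ) 𝓘(ℂ, Fin N → ℂ) ω F := by
    intro t
    have hev : F =ᶠ[𝓝 t] G ∘ extChartAt 𝓘(ℂ, Fin n → ℂ) t := by
      filter_upwards [extChartAt_source_mem_nhds (I := 𝓘(ℂ, Fin n → ℂ)) t] with t' ht'
      have e : t' = ComplexTorus.cover Φ (extChartAt 𝓘(ℂ, Fin n → ℂ) t t') := by
        rw [← ComplexTorus.extChartAt_symm_eq_cover Φ (𝕜 := ℂ) t]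
        exact ((extChartAt 𝓘(ℂ, Fin n → ℂ) t).left_inv ht').symm
      calc F t' = F (ComplexTorus.cover Φ (extChartAt 𝓘(ℂ, Fin n → ℂ) t t')) := by rw [← e]
        _ = G (extChartAt 𝓘(ℂ, Fin n → ℂ) t t') := hFcover _
    exact ((hGsmooth _).comp t contMDiffAt_extChartAt).congr_of_eventuallyEq hev
  refine ⟨N, F, hFsmooth, ?_, ?_⟩
  · -- injectivity
    intro t₁ t₂ h
    obtain ⟨z₁, rfl⟩ := ComplexTorus.cover_surjective Φ t₁
    obtain ⟨z₂, rfl⟩ := ComplexTorus.cover_surjective Φ t₂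
    rw [hFcover, hFcover] at h
    simp only [hG] at h
    rw [Projectivization.mk_eq_mk_iff'] at h
    obtain ⟨a, ha⟩ := h
    have hprop : ∀ c₃, f c₃ z₁ = a * f c₃ z₂ := by
      intro c₃
      have := congrFun ha (σ.symm c₃)
      simp only [hgv, Pi.smul_apply, smul_eq_mul, Equiv.apply_symm_apply] at this
      exact this.symm
    obtain ⟨m, n', hmn⟩ := hinj z₂ z₁ a hprop
    have hz : z₁ = z₂ + ComplexTorus.latticeVec Φ (Sum.elim m n') := by
      funext i
      rw [Pi.add_apply, latticeVec_siegel Ω Φ hΦ]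
      simp only [Sum.elim_inl, Sum.elim_inr]
      have := hmn i
      linear_combination this
    rw [hz, ComplexTorus.cover_add_latticeVec]
  · -- immersion
    intro t
    obtain ⟨z, rfl⟩ := ComplexTorus.cover_surjective Φ t
    have hFmd : MDifferentiableAt 𝓘(ℂ, Fin n → ℂ) 𝓘(ℂ, Fin N → ℂ) F (ComplexTorus.cover Φ z) :=
      (hFsmooth _).mdifferentiableAt (by simp)
    have hchain := mfderiv_comp z hFmd (ComplexTorus.mdifferentiable_cover Φ (𝕜 := ℂ) z)
    rw [ComplexTorus.mfderiv_cover, show F ∘ ComplexTorus.cover Φ = G from funext hFcover] at hchain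
    -- `hchain : mfderiv G z = (mfderiv F (π z)).comp id`
    refine (injective_iff_map_eq_zero _).mpr fun u hu => ?_
    have hu' : mfderiv 𝓘(ℂ, Fin n → ℂ) 𝓘(ℂ, Fin N → ℂ) G z u = 0 := by
      rw [hchain]
      exact hu
    obtain ⟨μ, hμ⟩ := exists_eq_mul_of_mfderiv_projectivizationMk_eq_zero hgv0 hgvc (hgvd z) hu'
    refine himm z u μ fun c₃ => ?_
    have := hμ (σ.symm c₃)
    simpa only [hgv, Equiv.apply_symm_apply] using this

end ThetaEmbedding

end Literature.Geometry.Kaehler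

end
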